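import Summits.HodgeConjecture.HodgeConjecture.Theorems.PadicSemiregularLiftFermatAnchorAssemblyStubReadoutRescale
import Mathlib.RingTheory.RootsOfUnity.Complex
import Mathlib.RingTheory.Polynomial.Cyclotomic.Roots
import Mathlib.FieldTheory.Minpoly.IsIntegrallyClosed
import Mathlib.Analysis.Fourier.FiniteAbelian.PontryaginDuality

/-!
# Stub `stub_readout` of line `witt-lift-rigid-mf` (crux `FermatAnchorAssembly`, stmt-HodgeConjecture-14874): the charge polynomial is divisible by `Φₘ` off the grading group

Route `PadicSemiregularLift` of `HodgeConjecture`, crux `FermatAnchorAssembly`, line `witt-lift-rigid-mf`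
(vocabulary `Theorems/PadicSemiregularLiftFermatAnchorAssemblyGMFDefs.lean`; companions
`…StubReadout.lean`, `…StubReadoutRescale.lean`). The registered stub `stub_readout` reads `claim(γ)` off
the hypothesis `Φₘ ∤ Θ_{γ,N}` for a lawful `L`-graded matrix factorization `N` of `Σ_{i<ν} xᵢᵐ`, where
`Θ_{γ,N}(T) = Σ_{g ∈ (ℤ/m)^ν} χ(N, g^*N) T^{⟨γ,g⟩}` and the grading subgroup `L ≤ (ℤ/m)^ν` is a FREE
parameter. This file proves that the freedom is harmless: for `γ ∉ L` the hypothesis is contradictory.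

* `thetaPoly_dvd_of_pairing_ne_zero` — if some `h` with `⟨h, L⟩ = 0` has `⟨h, γ⟩ ≠ 0` then `Φₘ ∣ Θ_{γ,N}`:
  evaluate at `μ = e^{2πi/m} ∈ ℂ` (`Φₘ = minpoly_ℤ μ`, so `Φₘ ∣ P ↔ P(μ) = 0` by Gauss's lemma,
  Mathlib `Polynomial.cyclotomic_eq_minpoly` + `minpoly.isIntegrallyClosed_dvd`); the reindexing `g ↦ g + h`
  leaves `Θ(μ)` unchanged but multiplies it by `μ^{⟨γ,h⟩} ≠ 1`, because `χ(N, (g+h)^*N) = χ(N, g^*N)`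
  (`eulerForm_twist_add`, file `…StubReadoutRescale`);
* `exists_pairing_ne_zero_of_not_mem` — duality `L^⊥⊥ ⊆ L` in `(ℤ/m)^ν`: complex characters of the finite
  abelian group `(ℤ/m)^ν/L` separate points (Mathlib `AddChar.exists_apply_ne_zero`), and every character of
  `(ℤ/m)^ν` is `x ↦ e^{2πi⟨h,x⟩/m}` (injective in `h`, and `|((ℤ/m)^ν)^∧| = |(ℤ/m)^ν|`, `AddChar.card_eq`);
* `thetaPoly_dvd_of_not_mem` — **registered helper sub-goal**: `γ ∉ L → Φₘ ∣ Θ_{γ,N}` for every lawful `N`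
  over every field and every `ζ` with `ζᵐ = 1`. Hence `stub_readout` holds vacuously for `γ ∉ L`, and every
  rigid charged seed `RigidSeed M' γ` (whose field `charged` is `Φ_{M'} ∤ Θ_{γ,M}`) has `γ ∈ L`.

Sorry-free; axioms ⊆ {propext, Classical.choice, Quot.sound}; no named fact is introduced.
-/

-- `Summit.HodgeConjecture.HodgeConjecture.…` is the tree's mandated summit/problem namespace (single-problem summit).
set_option linter.dupNamespace false

noncomputable section

open Finset

namespace Summit.HodgeConjecture.HodgeConjecture.Cruxes.FermatAnchorAssembly.WittLiftRigidMf

variable {K : Type} [Field K] {ν m : ℕ}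

section Charge

variable [NeZero m] {L : AddSubgroup (Fin ν → ZMod m)} {ι₀ ι₁ : Type} [Fintype ι₀] [Fintype ι₁]
  [DecidableEq ι₀] [DecidableEq ι₁]

/-- **`Φₘ ∣ Θ_{γ,N}` as soon as some `h ∈ L^⊥` has `⟨h, γ⟩ ≠ 0`.** Evaluate at the primitive root
`μ = e^{2πi/m} ∈ ℂ` (`Φₘ = minpoly_ℤ μ`): `Θ(μ) = Σ_g χ(N, g^*N) μ^{⟨γ,g⟩}` is unchanged by the reindexing
`g ↦ g + h`, which multiplies it by `μ^{⟨γ,h⟩} ≠ 1` (`eulerForm_twist_add`), so `Θ(μ) = 0`. [folklore] -/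
theorem thetaPoly_dvd_of_pairing_ne_zero (N : GMF K ν m L ι₀ ι₁) {ζ : K} (hζ : ζ ^ m = 1)
    (γ : Fin ν → ZMod m) {h : Fin ν → ZMod m} (hh : ∀ l ∈ L, ∑ i, h i * l i = 0)
    (hγ : ∑ i, h i * γ i ≠ 0) : Polynomial.cyclotomic m ℤ ∣ GMFData.thetaPoly K L ζ γ N.toGMFData := by
  have hm : 0 < m := Nat.pos_of_ne_zero (NeZero.ne m)
  have hμ := Complex.isPrimitiveRoot_exp m (NeZero.ne m)
  set μ := Complex.exp (2 * Real.pi * Complex.I / m) with hμdef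
  have hμm : μ ^ m = 1 := hμ.pow_eq_one
  rw [Polynomial.cyclotomic_eq_minpoly hμ hm]
  apply minpoly.isIntegrallyClosed_dvd (hμ.isIntegral hm)
  unfold GMFData.thetaPoly
  simp only [map_sum, Polynomial.aeval_monomial, algebraMap_int_eq, eq_intCast]
  -- `F g = χ(N, g^*N) μ^{⟨γ, g⟩}` satisfies `F (g + h) = μ^{⟨γ,h⟩} F g`
  set F : (Fin ν → ZMod m) → ℂ := fun g ↦
    (GMFData.eulerForm K L N.toGMFData (N.toGMFData.twist ζ g) : ℂ) * μ ^ (∑ i, γ i * g i).val with hF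
  set s : ZMod m := ∑ i, γ i * h i with hs
  have hs0 : s ≠ 0 := by
    rw [hs, show ∑ i, γ i * h i = ∑ i, h i * γ i from Finset.sum_congr rfl fun i _ ↦ mul_comm _ _]
    exact hγ
  have hshift : ∀ g, F (g + h) = μ ^ s.val * F g := by
    intro g
    simp only [hF]
    rw [eulerForm_twist_add N hζ g hh]
    have : ∑ i, γ i * (g + h) i = ∑ i, γ i * g i + s := by
      simp only [hs, Pi.add_apply, mul_add, Finset.sum_add_distrib]
    rw [this, pow_val_add hμm]
    ring
  have hsum : ∑ g, F g = μ ^ s.val * ∑ g, F g :=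
    calc ∑ g, F g = ∑ g, F (g + h) := (Fintype.sum_equiv (Equiv.addRight h) _ _ fun _ ↦ rfl).symm
      _ = ∑ g, μ ^ s.val * F g := Finset.sum_congr rfl fun g _ ↦ hshift g
      _ = μ ^ s.val * ∑ g, F g := (Finset.mul_sum _ _ _).symm
  have hne : μ ^ s.val ≠ 1 := by
    rw [Ne, hμ.pow_eq_one_iff_dvd]
    exact fun hdvd ↦ hs0 ((ZMod.val_eq_zero s).mp (Nat.eq_zero_of_dvd_of_lt hdvd (ZMod.val_lt s)))
  have hzero : (1 - μ ^ s.val) * ∑ g, F g = 0 := by rw [sub_mul, one_mul, ← hsum, sub_self]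
  rcases mul_eq_zero.mp hzero with h1 | h2
  · exact absurd (sub_eq_zero.mp h1).symm hne
  · simpa [hF] using h2

/-- **Duality for `(ℤ/m)^ν`: `L^⊥⊥ ⊆ L`.** If `γ ∉ L` then some `h` pairing to zero with all of `L` has
`⟨h, γ⟩ ≠ 0` (characters of the finite abelian group `(ℤ/m)^ν/L` separate points, and every complex
character of `(ℤ/m)^ν` is `x ↦ e^{2πi⟨h,x⟩/m}`, by counting). [folklore] -/
theorem exists_pairing_ne_zero_of_not_mem (L : AddSubgroup (Fin ν → ZMod m)) {γ : Fin ν → ZMod m}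
    (hγ : γ ∉ L) : ∃ h : Fin ν → ZMod m, (∀ l ∈ L, ∑ i, h i * l i = 0) ∧ ∑ i, h i * γ i ≠ 0 := by
  classical
  -- the standard character `E(a) = e^{2πi a/m}` of `ℤ/m` is injective
  set E : AddChar (ZMod m) ℂ := AddChar.zmodAddEquiv (n := m) 1 with hEdef
  have hE1 : ∀ a, E a = ((AddChar.zmod m 1 a : Circle) : ℂ) := fun a ↦ rfl
  have hE2 : ∀ a : ZMod m, AddChar.zmod m 1 a = AddCircle.toCircle (ZMod.toAddCircle (1 * a)) :=
    fun a ↦ rfl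
  have hE : Function.Injective E := by
    intro a b hab
    rw [hE1, hE1] at hab
    have h1 : AddChar.zmod m 1 a = AddChar.zmod m 1 b := Subtype.val_injective hab
    rw [hE2, hE2] at h1
    simpa using (ZMod.toAddCircle_injective m) (AddCircle.injective_toCircle one_ne_zero h1)
  -- every character of `(ℤ/m)^ν` is `x ↦ E ⟨h, x⟩`
  let pair : (Fin ν → ZMod m) → (Fin ν → ZMod m) →+ ZMod m := fun h ↦
    AddMonoidHom.mk' (fun x ↦ ∑ i, h i * x i) (fun x y ↦ by
      simp only [Pi.add_apply, mul_add, Finset.sum_add_distrib])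
  let Φ : (Fin ν → ZMod m) → AddChar (Fin ν → ZMod m) ℂ := fun h ↦ E.compAddMonoidHom (pair h)
  have hΦapply : ∀ h x, Φ h x = E (∑ i, h i * x i) := fun h x ↦ rfl
  have hΦ : Function.Injective Φ := by
    intro h h' hh'
    funext i
    apply hE
    simpa [hΦapply, Pi.single_apply] using DFunLike.congr_fun hh' (Pi.single i 1)
  have hΦs : Function.Surjective Φ :=
    ((Fintype.bijective_iff_injective_and_card Φ).mpr ⟨hΦ, (AddChar.card_eq).symm⟩).surjective
  -- a character of the quotient that sees `γ`
  have hγ' : (QuotientAddGroup.mk γ : (Fin ν → ZMod m) ⧸ L) ≠ 0 := by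
    rwa [Ne, QuotientAddGroup.eq_zero_iff]
  obtain ⟨ψ, hψ⟩ := (AddChar.exists_apply_ne_zero (α := (Fin ν → ZMod m) ⧸ L)).mpr hγ'
  obtain ⟨h, hh⟩ := hΦs (ψ.compAddMonoidHom (QuotientAddGroup.mk' L))
  refine ⟨h, fun l hl ↦ ?_, fun h0 ↦ hψ ?_⟩
  · have hl' := DFunLike.congr_fun hh l
    rw [hΦapply, AddChar.compAddMonoidHom_apply, QuotientAddGroup.mk'_apply,
      (QuotientAddGroup.eq_zero_iff l).mpr hl, AddChar.map_zero_eq_one] at hl'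
    exact hE (hl'.trans E.map_zero_eq_one.symm)
  · have hγ2 := DFunLike.congr_fun hh γ
    rw [hΦapply, h0, AddChar.map_zero_eq_one, AddChar.compAddMonoidHom_apply,
      QuotientAddGroup.mk'_apply] at hγ2
    exact hγ2.symm

/-- **Registered helper sub-goal `thetaPoly_dvd_of_not_mem` (sub-case of `stub_readout`): for a character
`γ` OUTSIDE the grading group `L`, the charge polynomial `Θ_{γ,N}` of every lawful `L`-graded factorization
`N` of `Σ xᵢᵐ`, over any field and any `ζ` with `ζᵐ = 1`, is divisible by `Φₘ`.** So the hypothesis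
`Φₘ ∤ Θ_{γ,N}` of the readout forces `γ ∈ L` (the free parameter `L` of the stub is harmless: for `γ ∉ L`
the stub holds vacuously), and every rigid charged seed `RigidSeed M' γ` has `γ ∈ L`. [folklore] -/
theorem thetaPoly_dvd_of_not_mem : ∀ (ν m : ℕ) [NeZero m] (K : Type) [Field K] (ζ : K), ζ ^ m = 1 → ∀ (γ : Fin ν → ZMod m) (ι₀ ι₁ : Type) [Fintype ι₀] [Fintype ι₁] [DecidableEq ι₀] [DecidableEq ι₁] (L : AddSubgroup (Fin ν → ZMod m)) (N : GMF K ν m L ι₀ ι₁), γ ∉ L → Polynomial.cyclotomic m ℤ ∣ GMFData.thetaPoly K L ζ γ N.toGMFData := by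
  intro ν m _ K _ ζ hζ γ ι₀ ι₁ _ _ _ _ L N hγ
  obtain ⟨h, hh, hhγ⟩ := exists_pairing_ne_zero_of_not_mem L hγ
  exact thetaPoly_dvd_of_pairing_ne_zero N hζ γ hh hhγ

end Charge

end Summit.HodgeConjecture.HodgeConjecture.Cruxes.FermatAnchorAssembly.WittLiftRigidMf

end
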